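import Mathlib.MeasureTheory.Measure.ProbabilityMeasure
import Mathlib.Probability.Kernel.Invariance
import Mathlib.Analysis.SpecialFunctions.Log.Base
import Mathlib.Topology.ContinuousMap.Bounded.Basic
import HarnessLib

/-!
# Furstenberg's CP-chain on the dyadic tree of the unit cube (base `2`, any dimension `d`)

Topic `Dynamics/FractalDistributions`. Definition request `defn-OctreeCPChain` of route
`Summits/CriticalPhenomena/Ising3DConformalLimit/Theses/OctantEntropy` (`d = 3`: eight octants).
Printed notion: Hochman–Shmerkin, Ann. of Math. 175 (2012), Def. 7.6 (read on `paper:arxiv-0910.1956`,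
§7.4): "A CP-chain … is a stationary Markov process `(μ_n, B_n)`, where the state space is the space of
pairs `(μ, B)` in which `B` is a box and `μ` is a probability measure supported on `B*`, and the
transition is given by the law: for `B ∈ Δ(A*)`, `(μ, A) ↦ (μ^B, B)` with probability `μ(B)` … The
stationary process `(μ_n)` is called the measure component … Furstenberg's CP-chains are recovered
using the base-`b` partition operator" (origin: Furstenberg, ETDS 28 (2008), §1–2; equivalent
`M_b`-invariant "adapted distribution" form: Hochman 2010, Def. 1.10–1.12, `paper:arxiv-1008.3731`).

Here (REAL definitions, every stated lemma proved, no named facts) is the MEASURE COMPONENT of the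
base-2 chain on `ℝ^d`: the half-open unit cube `unitCube`, its `2^d` children `childCube ε`
(`ε : Octant d = Fin d → Fin 2`) and blow-ups `blowUp ε : x ↦ 2x - ε`; the states `CPState d`
(probability measures on `ℝ^d` carried by `[0,1)^d`, a subtype of Mathlib's `ProbabilityMeasure`:
Giry σ-algebra and weak topology); the CP step `zoomState θ ε = θ^{C_ε}` (junk `θ` on the
probability-`0` branch `θ(C_ε) = 0`); the **transition kernel** `cpKernel d` (Markov,
`θ ↦ ∑_ε θ(C_ε) δ_{θ^{C_ε}}`); **CP-distributions** `IsCPDistribution` (Mathlib `Kernel.Invariant`)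
and `IsErgodicCPDistribution` (a.e.-invariant sets trivial); the chain run forward (`cellMass`,
`zoomAlong`, `lawAt θ k`, Cesàro average `cesaroLaw θ K`, Hochman–Shmerkin §7.5) with
`lawAt_zero`, `lawAt_one : lawAt θ 1 = cpKernel θ`; `ConvergesInLaw` and
**`IsUniformlyScalingAlong θ P`** (Cesàro laws from `θ_K` run for `K` steps converge to the
CP-distribution `P`: the zoom-OUT reading of "`μ` generates `P`", Hochman 2010 Def. 1.6–1.7,
Hochman–Shmerkin Def. 7.2, for a sequence of initial states as the route needs); the lattice
embedding `latticeState d K A` of a finite `A ⊆ [-2^K, 2^K)^d ∩ ℤ^d`; and the octant-splitting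
entropy `splittingEntropy θ = -∑_ε θ(C_ε) log₂ θ(C_ε)` (its `P`-mean is the dimension of an
ergodic CP-distribution — Furstenberg 2008 Thm. 2.1, Hochman 2010 Prop. 1.19 — NOT stated here).

Design: states live on all of `ℝ^d` (blow-ups globally affine; Mathlib supplies σ-algebra and
topology); test functions in `ConvergesInLaw` are weakly continuous AND Giry-measurable (equal
σ-algebras on a Polish space, so no restriction; avoids the junk Bochner integral). Mathlib has
kernels, `Kernel.Invariant`, the Giry monad and the weak topology; no CP-chains or sceneries.

References: Furstenberg, ETDS 28 (2008) 405–422, §1–2, Thm. 2.1 [Furstenberg2008] (not held,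
acq-02590); Hochman, arXiv:1008.3731, Def. 1.6–1.12, Prop. 1.19 [Hochman2010FractalDistributions];
Hochman–Shmerkin, Ann. of Math. 175 (2012), §7.4–7.5 [HochmanShmerkin2012].
-/

noncomputable section

open MeasureTheory ProbabilityTheory Set Filter
open scoped ENNReal Topology BoundedContinuousFunction

namespace Literature.Dynamics.FractalDistributions

variable (d : ℕ)
/-- Octant indices: digit vectors `ε ∈ {0,1}^d` (for `d = 3`, the eight octants). [folklore] -/
abbrev Octant : Type := Fin d → Fin 2

/-- The half-open unit cube `[0,1)^d ⊆ ℝ^d` (on the plain product `Fin d → ℝ`; the namesake in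
`Analysis/FunctionSpaces/FlatTorus` lives on `EuclideanSpace ℝ d` and serves the torus). [folklore] -/
def unitCube : Set (Fin d → ℝ) := Set.pi univ fun _ => Ico 0 1

/-- The child `C_ε = ∏_i [ε_i/2, (ε_i+1)/2)` of the unit cube (the base-2 cells `𝒟_2` of
Hochman 2010 §1.4 / the partition `Δ([0,1)^d)` of Hochman–Shmerkin 2012, Def. 7.4, half-open
convention). [cite: HochmanShmerkin2012, Def. 7.4] -/
def childCube (ε : Octant d) : Set (Fin d → ℝ) :=
  Set.pi univ fun i => Ico (((ε i : ℕ) : ℝ) / 2) ((((ε i : ℕ) : ℝ) + 1) / 2)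

/-- The affine blow-up `x ↦ 2x - ε` carrying `C_ε` onto `[0,1)^d` (the rescaling `T_B` in `μ^B`,
Hochman–Shmerkin 2012 §7.3; the magnification `M_b`, Hochman 2010 Def. 1.10). [cite: Hochman2010FractalDistributions, Def. 1.10] -/
def blowUp (ε : Octant d) (x : Fin d → ℝ) : Fin d → ℝ := fun i => 2 * x i - ((ε i : ℕ) : ℝ)

variable {d}

/-- The unit cube is measurable. [folklore] -/
theorem measurableSet_unitCube : MeasurableSet (unitCube d) := .univ_pi fun _ => measurableSet_Ico

/-- Each child cube is measurable. [folklore] -/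
theorem measurableSet_childCube (ε : Octant d) : MeasurableSet (childCube d ε) :=
  MeasurableSet.univ_pi fun _ => measurableSet_Ico

/-- The blow-ups are measurable (indeed continuous affine). [folklore] -/
theorem measurable_blowUp (ε : Octant d) : Measurable (blowUp d ε) :=
  measurable_pi_lambda _ fun i => ((measurable_pi_apply i).const_mul 2).sub_const _

/-- `blowUp ε ⁻¹' [0,1)^d = C_ε`: the blow-up carries exactly the child `C_ε` onto the unit cube.
[folklore] -/
theorem preimage_blowUp_unitCube (ε : Octant d) : blowUp d ε ⁻¹' unitCube d = childCube d ε := by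
  ext x
  simp only [mem_preimage, unitCube, childCube, mem_univ_pi, mem_Ico, blowUp]
  refine forall_congr' fun i => ?_
  constructor <;> rintro ⟨h1, h2⟩ <;> constructor <;> linarith

/-- The children cover the unit cube. [folklore] -/
theorem exists_mem_childCube_of_mem_unitCube {x : Fin d → ℝ} (hx : x ∈ unitCube d) :
    ∃ ε : Octant d, x ∈ childCube d ε := by
  simp only [unitCube, childCube, mem_univ_pi, mem_Ico] at hx ⊢
  refine ⟨fun i => if x i < 1 / 2 then 0 else 1, fun i => ?_⟩
  obtain ⟨h0, h1⟩ := hx i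
  by_cases h : x i < 1 / 2
  · simp only [if_pos h, Fin.val_zero, Nat.cast_zero, zero_div, zero_add]
    exact ⟨h0, by linarith⟩
  · simp only [if_neg h, Fin.val_one, Nat.cast_one]
    exact ⟨by linarith, by linarith⟩

/-- The children are contained in the unit cube. [folklore] -/
theorem childCube_subset_unitCube (ε : Octant d) : childCube d ε ⊆ unitCube d := by
  intro x hx
  simp only [childCube, unitCube, mem_univ_pi, mem_Ico] at hx ⊢
  intro i
  have h0 : (0 : ℝ) ≤ ((ε i : ℕ) : ℝ) := Nat.cast_nonneg _
  have h1 : ((ε i : ℕ) : ℝ) ≤ 1 := by exact_mod_cast Nat.lt_succ_iff.mp (ε i).isLt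
  constructor <;> linarith [(hx i).1, (hx i).2]

/-- Distinct children are disjoint (the digit `ε_i` is `⌊2 x_i⌋`). [folklore] -/
theorem disjoint_childCube {ε ε' : Octant d} (h : ε ≠ ε') :
    Disjoint (childCube d ε) (childCube d ε') := by
  obtain ⟨i, hi⟩ := Function.ne_iff.mp h
  refine Set.disjoint_left.mpr fun x hx hx' => hi (Fin.ext ?_)
  simp only [childCube, mem_univ_pi, mem_Ico] at hx hx'
  obtain ⟨a1, a2⟩ := hx i
  obtain ⟨b1, b2⟩ := hx' i
  have h3 : ((ε i : ℕ) : ℝ) < (ε' i : ℕ) + 1 := by linarith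
  have h4 : ((ε' i : ℕ) : ℝ) < (ε i : ℕ) + 1 := by linarith
  have h3' : (ε i : ℕ) < (ε' i : ℕ) + 1 := by exact_mod_cast h3
  have h4' : (ε' i : ℕ) < (ε i : ℕ) + 1 := by exact_mod_cast h4
  omega

/-- The unit cube is the disjoint union of its children, at the level of any measure:
`∑_ε θ(C_ε) = θ([0,1)^d)`. [folklore] -/
theorem sum_measure_childCube (θ : Measure (Fin d → ℝ)) :
    ∑ ε : Octant d, θ (childCube d ε) = θ (unitCube d) := by
  rw [← measure_biUnion_finset (fun ε _ ε' _ hne => disjoint_childCube hne)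
    fun ε _ => measurableSet_childCube ε]
  congr 1
  ext x
  simp only [mem_iUnion, Finset.mem_univ, exists_prop, true_and]
  exact ⟨fun ⟨ε, hε⟩ => childCube_subset_unitCube ε hε, exists_mem_childCube_of_mem_unitCube⟩

variable (d) in
/-- **States of the CP-chain**: probability measures on `ℝ^d` carried by the half-open unit cube
(`θ([0,1)^d) = 1`; "a probability measure supported on `B*`", Hochman–Shmerkin 2012 Def. 7.6, the box
normalised to the unit cube); a subtype of Mathlib's `ProbabilityMeasure` (Giry σ-algebra, weak
topology). [cite: HochmanShmerkin2012, Def. 7.6] -/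
def CPState : Type :=
  {θ : ProbabilityMeasure (Fin d → ℝ) // (θ : Measure (Fin d → ℝ)) (unitCube d) = 1}

namespace CPState

/-- The Giry measurable structure on states (subtype of `ProbabilityMeasure`). [folklore] -/
instance : MeasurableSpace (CPState d) := Subtype.instMeasurableSpace
/-- The weak topology on states (subtype of `ProbabilityMeasure`). [folklore] -/
instance : TopologicalSpace (CPState d) := instTopologicalSpaceSubtype

/-- The underlying measure of a state. [folklore] -/
@[coe] def toMeasure (θ : CPState d) : Measure (Fin d → ℝ) :=
  (θ.1 : ProbabilityMeasure (Fin d → ℝ)).toMeasure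

/-- States coerce to measures on `ℝ^d`. [folklore] -/
instance : Coe (CPState d) (Measure (Fin d → ℝ)) := ⟨toMeasure⟩
/-- The underlying measure of a state is a probability measure. [folklore] -/
instance (θ : CPState d) : IsProbabilityMeasure (θ : Measure (Fin d → ℝ)) := θ.1.2

/-- A state gives full mass to the unit cube. [folklore] -/
theorem measure_unitCube (θ : CPState d) : (θ : Measure (Fin d → ℝ)) (unitCube d) = 1 := θ.2

/-- `θ ↦ (θ : Measure ℝ^d)` is measurable (composition of two subtype coercions). [folklore] -/
theorem measurable_toMeasure : Measurable (toMeasure : CPState d → Measure (Fin d → ℝ)) :=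
  measurable_subtype_coe.comp measurable_subtype_coe

/-- `θ ↦ θ(s)` is measurable on states for measurable `s`. [folklore] -/
theorem measurable_apply {s : Set (Fin d → ℝ)} (hs : MeasurableSet s) :
    Measurable fun θ : CPState d => (θ : Measure (Fin d → ℝ)) s :=
  (Measure.measurable_coe hs).comp measurable_toMeasure

end CPState

variable (d) in
/-- **The CP step on measures**: `θ^{C_ε} = (θ C_ε)⁻¹ • (θ|_{C_ε}) ∘ (blowUp ε)⁻¹` — condition on the
child `C_ε` and blow it up to the unit cube ("`μ^B`", Hochman–Shmerkin 2012 §7.3–7.4; `M_b^□`, Hochman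
2010 Def. 1.10); junk value `θ` when `θ(C_ε) = 0` (probability-`0` branch). [cite: HochmanShmerkin2012, Def. 7.6] -/
def zoomMeasure (θ : Measure (Fin d → ℝ)) (ε : Octant d) : Measure (Fin d → ℝ) :=
  if θ (childCube d ε) = 0 then θ
  else (θ (childCube d ε))⁻¹ • (θ.restrict (childCube d ε)).map (blowUp d ε)

/-- Values of the zoomed measure on measurable sets. [folklore] -/
theorem zoomMeasure_apply (θ : Measure (Fin d → ℝ)) (ε : Octant d) {s : Set (Fin d → ℝ)}
    (hs : MeasurableSet s) :
    zoomMeasure d θ ε s = if θ (childCube d ε) = 0 then θ s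
      else (θ (childCube d ε))⁻¹ * θ (blowUp d ε ⁻¹' s ∩ childCube d ε) := by
  unfold zoomMeasure
  split_ifs with h
  · rfl
  · rw [Measure.smul_apply, Measure.map_apply (measurable_blowUp ε) hs,
      Measure.restrict_apply ((measurable_blowUp ε) hs), smul_eq_mul]

/-- The zoomed measure of a state is a probability measure. [folklore] -/
theorem isProbabilityMeasure_zoomMeasure (θ : CPState d) (ε : Octant d) :
    IsProbabilityMeasure (zoomMeasure d (θ : Measure (Fin d → ℝ)) ε) := by
  by_cases h : (θ : Measure (Fin d → ℝ)) (childCube d ε) = 0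
  · rw [zoomMeasure, if_pos h]; infer_instance
  · refine ⟨?_⟩
    rw [zoomMeasure_apply _ ε MeasurableSet.univ, if_neg h, preimage_univ, univ_inter]
    exact ENNReal.inv_mul_cancel h (measure_ne_top _ _)

/-- The zoomed measure of a state is carried by the unit cube. [folklore] -/
theorem zoomMeasure_unitCube (θ : CPState d) (ε : Octant d) :
    zoomMeasure d (θ : Measure (Fin d → ℝ)) ε (unitCube d) = 1 := by
  by_cases h : (θ : Measure (Fin d → ℝ)) (childCube d ε) = 0
  · rw [zoomMeasure, if_pos h]
    exact θ.measure_unitCube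
  · rw [zoomMeasure_apply _ ε measurableSet_unitCube, if_neg h, preimage_blowUp_unitCube,
      inter_self]
    exact ENNReal.inv_mul_cancel h (measure_ne_top _ _)

/-- `θ ↦ θ^{C_ε}` is Giry-measurable on measures. [folklore] -/
theorem measurable_zoomMeasure (ε : Octant d) :
    Measurable fun θ : Measure (Fin d → ℝ) => zoomMeasure d θ ε := by
  refine Measure.measurable_of_measurable_coe _ fun s hs => ?_
  have hC := measurableSet_childCube (d := d) ε
  have hset : MeasurableSet {θ : Measure (Fin d → ℝ) | θ (childCube d ε) = 0} :=
    Measure.measurable_coe hC (measurableSet_singleton 0)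
  simp_rw [zoomMeasure_apply _ ε hs]
  refine Measurable.ite hset (Measure.measurable_coe hs) ?_
  exact (Measure.measurable_coe hC).inv.mul
    (Measure.measurable_coe (((measurable_blowUp ε) hs).inter hC))

variable (d) in
/-- **The CP step on states** `θ ↦ θ^{C_ε}` (a state again: `isProbabilityMeasure_zoomMeasure`,
`zoomMeasure_unitCube`). [cite: HochmanShmerkin2012, Def. 7.6] -/
def zoomState (θ : CPState d) (ε : Octant d) : CPState d :=
  ⟨⟨zoomMeasure d (θ : Measure (Fin d → ℝ)) ε, isProbabilityMeasure_zoomMeasure θ ε⟩,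
    zoomMeasure_unitCube θ ε⟩

/-- The underlying measure of `zoomState θ ε` is `zoomMeasure θ ε` (definitional). [folklore] -/
@[simp]
theorem CPState.toMeasure_zoomState (θ : CPState d) (ε : Octant d) :
    (zoomState d θ ε : Measure (Fin d → ℝ)) = zoomMeasure d (θ : Measure (Fin d → ℝ)) ε := rfl

/-- `θ ↦ θ^{C_ε}` is measurable on states. [folklore] -/
theorem measurable_zoomState (ε : Octant d) : Measurable fun θ : CPState d => zoomState d θ ε :=
  (((measurable_zoomMeasure ε).comp CPState.measurable_toMeasure).subtype_mk).subtype_mk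

variable (d) in
/-- The one-step transition measure `∑_ε θ(C_ε) δ_{θ^{C_ε}}` on states. [cite: HochmanShmerkin2012, Def. 7.6] -/
def cpMeasure (θ : CPState d) : Measure (CPState d) :=
  ∑ ε : Octant d, ((θ : Measure (Fin d → ℝ)) (childCube d ε)) • Measure.dirac (zoomState d θ ε)

/-- Values of the transition measure on measurable sets of states. [folklore] -/
theorem cpMeasure_apply (θ : CPState d) {A : Set (CPState d)} (hA : MeasurableSet A) :
    cpMeasure d θ A = ∑ ε : Octant d, (θ : Measure (Fin d → ℝ)) (childCube d ε) * A.indicator 1 (zoomState d θ ε) := by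
  simp only [cpMeasure, Measure.coe_finsetSum, Measure.coe_smul, Finset.sum_apply, Pi.smul_apply,
    Measure.dirac_apply' _ hA, smul_eq_mul]

/-- The transition measure depends measurably on the state. [folklore] -/
theorem measurable_cpMeasure : Measurable (cpMeasure d) := by
  refine Measure.measurable_of_measurable_coe _ fun A hA => ?_
  simp_rw [cpMeasure_apply _ hA]
  refine Finset.measurable_sum _ fun ε _ => ?_
  exact (CPState.measurable_apply (measurableSet_childCube ε)).mul
    ((measurable_one.indicator hA).comp (measurable_zoomState ε))

variable (d) in
/-- **The CP transition kernel** (base `2`, dimension `d`): from the state `θ` move to `θ^{C_ε}` with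
probability `θ(C_ε)` — "for `B ∈ Δ(A*)`, `(μ, A) ↦ (μ^B, B)` with probability `μ(B)`"
(Hochman–Shmerkin 2012, Def. 7.6, measure component; Furstenberg 2008 §2). A Markov kernel
(`instIsMarkovKernelCpKernel`). [cite: HochmanShmerkin2012, Def. 7.6] -/
def cpKernel : Kernel (CPState d) (CPState d) where
  toFun := cpMeasure d
  measurable' := measurable_cpMeasure

/-- Unfolding the kernel. [folklore] -/
@[simp] theorem cpKernel_apply (θ : CPState d) : cpKernel d θ = cpMeasure d θ := rfl
/-- The CP kernel is Markov: `∑_ε θ(C_ε) = θ([0,1)^d) = 1`. [cite: HochmanShmerkin2012, Def. 7.6] -/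
instance instIsMarkovKernelCpKernel : IsMarkovKernel (cpKernel d) := by
  refine ⟨fun θ => ⟨?_⟩⟩
  rw [cpKernel_apply, cpMeasure_apply θ MeasurableSet.univ]
  simp only [indicator_univ, Pi.one_apply, mul_one]
  rw [sum_measure_childCube, θ.measure_unitCube]

variable (d) in
/-- **CP-distribution** (base `2`, dimension `d`, measure component): a probability law `P` on states
that is stationary for the CP kernel, `P ∘ cpKernel = P` (Mathlib `Kernel.Invariant`) — the
distribution of a CP-chain in the sense of Hochman–Shmerkin 2012 Def. 7.6 ("a stationary Markov
process"); equivalently Furstenberg's CP-distributions / the `M_b`-invariant adapted distributions of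
Hochman 2010, Def. 1.12. [cite: HochmanShmerkin2012, Def. 7.6] -/
def IsCPDistribution (P : Measure (CPState d)) : Prop :=
  IsProbabilityMeasure P ∧ (cpKernel d).Invariant P

variable (d) in
/-- **Ergodic CP-distribution**: a CP-distribution all of whose almost invariant sets are trivial —
for every measurable set `A` of states with `cpKernel θ A = 𝟙_A(θ)` for `P`-a.e. `θ`, `P(A) ∈ {0, 1}`
(ergodicity of the stationary Markov chain, equivalently extremality of `P` among CP-distributions;
"an ergodic CP-chain", Hochman–Shmerkin 2012 §7.4, "the ergodic components of a Markov chain are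
Markov chains"). [cite: HochmanShmerkin2012, §7.4] -/
def IsErgodicCPDistribution (P : Measure (CPState d)) : Prop :=
  IsCPDistribution d P ∧ ∀ A : Set (CPState d), MeasurableSet A →
    (∀ᵐ θ ∂P, cpKernel d θ A = A.indicator 1 θ) → P A = 0 ∨ P A = 1

variable (d) in
/-- The mass `θ(D_w)` of the dyadic cell addressed by the word `w = ε₁ ε₂ … ε_k` of octants
(telescoping product of the one-step probabilities along `w`). [folklore] -/
def cellMass : CPState d → List (Octant d) → ℝ≥0∞
  | _, [] => 1
  | θ, ε :: w => (θ : Measure (Fin d → ℝ)) (childCube d ε) * cellMass (zoomState d θ ε) w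

variable (d) in
/-- The state `θ^{D_w}` reached by zooming successively along the word `w` of octants. [folklore] -/
def zoomAlong : CPState d → List (Octant d) → CPState d
  | θ, [] => θ
  | θ, ε :: w => zoomAlong (zoomState d θ ε) w

variable (d) in
/-- **The law of the chain at time `k`** started at `θ`: `∑_{|w| = k} θ(D_w) δ_{θ^{D_w}}` (the `k`-step
transition probability of `cpKernel` from `θ`, written out on the `2^{dk}` words). [cite: HochmanShmerkin2012, §7.5] -/
def lawAt (θ : CPState d) (k : ℕ) : Measure (CPState d) :=
  ∑ w : Fin k → Octant d, cellMass d θ (List.ofFn w) • Measure.dirac (zoomAlong d θ (List.ofFn w))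

/-- At time `0` the law is `δ_θ`. [folklore] -/
theorem lawAt_zero (θ : CPState d) : lawAt d θ 0 = Measure.dirac θ := by
  simp [lawAt, cellMass, zoomAlong]

/-- At time `1` the law is the kernel: `lawAt θ 1 = cpKernel θ`. [folklore] -/
theorem lawAt_one (θ : CPState d) : lawAt d θ 1 = cpKernel d θ := by
  rw [cpKernel_apply, cpMeasure, lawAt]
  refine Fintype.sum_equiv (Equiv.funUnique (Fin 1) (Octant d)) _ _ fun w => ?_
  simp [cellMass, zoomAlong, List.ofFn_succ]

variable (d) in
/-- **Cesàro average of the laws over times `0, …, K`**: `(K+1)⁻¹ ∑_{k ≤ K} lawAt θ k` ("if one averages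
the distributions at times `1, 2, …, n` …", Hochman–Shmerkin 2012, §7.5; the scenery distributions of
Hochman 2010, Def. 1.6, along `2`-adic cells). [cite: HochmanShmerkin2012, §7.5] -/
def cesaroLaw (θ : CPState d) (K : ℕ) : Measure (CPState d) :=
  ((K : ℝ≥0∞) + 1)⁻¹ • ∑ k ∈ Finset.range (K + 1), lawAt d θ k

variable (d) in
/-- **Convergence of laws on states**: `Λ_K → P` against every bounded test function
`F : CPState d → ℝ` that is continuous for the weak topology and Giry-measurable,
`∫ F dΛ_K → ∫ F dP`. [cite: Hochman2010FractalDistributions, Def. 1.7] -/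
def ConvergesInLaw (Λ : ℕ → Measure (CPState d)) (P : Measure (CPState d)) : Prop :=
  ∀ F : CPState d →ᵇ ℝ, Measurable F →
    Tendsto (fun K => ∫ θ, F θ ∂(Λ K)) atTop (𝓝 (∫ θ, F θ ∂P))

variable (d) in
/-- **Uniform scaling along a sequence of states (coarse direction)**: the Cesàro laws of the CP-chain
started at `θ_K` and run for `K` steps converge, as `K → ∞`, to the CP-distribution `P` — the zoom-out
form of "`μ` generates `P`" / "uniformly scaling" (Hochman 2010, Def. 1.6–1.7; Hochman–Shmerkin 2012,
Def. 7.2); in route `OctantEntropy`, `θ_K = latticeState d K (cluster ∩ W_K)`. [cite: Hochman2010FractalDistributions, Def. 1.7] -/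
def IsUniformlyScalingAlong (θ : ℕ → CPState d) (P : Measure (CPState d)) : Prop :=
  IsCPDistribution d P ∧ ConvergesInLaw d (fun K => cesaroLaw d (θ K) K) P

variable (d) in
/-- The point of `[0,1)^d` representing the lattice site `u ∈ [-2^K, 2^K)^d ∩ ℤ^d` at level `K`:
`u ↦ (u + 2^K) / 2^{K+1}` coordinatewise. [folklore] -/
def latticePoint (K : ℕ) (u : Fin d → ℤ) : Fin d → ℝ := fun i => ((u i : ℝ) + 2 ^ K) / 2 ^ (K + 1)

/-- Sites of the dyadic window `[-2^K, 2^K)^d` land in the unit cube. [folklore] -/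
theorem latticePoint_mem_unitCube {K : ℕ} {u : Fin d → ℤ}
    (hu : ∀ i, -(2 ^ K : ℤ) ≤ u i ∧ u i < 2 ^ K) : latticePoint d K u ∈ unitCube d := by
  refine fun i _ => ⟨div_nonneg ?_ (by positivity), (div_lt_one (by positivity)).mpr ?_⟩
  · have h1 : -(2 ^ K : ℝ) ≤ u i := by exact_mod_cast (hu i).1
    linarith
  · have h2 : (u i : ℝ) < 2 ^ K := by exact_mod_cast (hu i).2
    rw [pow_succ]
    linarith

variable (d) in
/-- The normalised counting measure `|A|⁻¹ ∑_{u ∈ A} δ_{p_K(u)}` of a finite set of sites, rescaled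
into the unit cube. [folklore] -/
def latticeMeasure (K : ℕ) (A : Finset (Fin d → ℤ)) : Measure (Fin d → ℝ) :=
  ((A.card : ℝ≥0∞))⁻¹ • ∑ u ∈ A, Measure.dirac (latticePoint d K u)

/-- Values of the lattice measure. [folklore] -/
theorem latticeMeasure_apply (K : ℕ) (A : Finset (Fin d → ℤ)) {s : Set (Fin d → ℝ)}
    (hs : MeasurableSet s) :
    latticeMeasure d K A s = ((A.card : ℝ≥0∞))⁻¹ * ∑ u ∈ A, s.indicator 1 (latticePoint d K u) := by
  simp only [latticeMeasure, Measure.smul_apply, Measure.coe_finsetSum, Finset.sum_apply,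
    Measure.dirac_apply' _ hs, smul_eq_mul]

variable (d) in
/-- **The state of a finite set of sites at level `K`** (route `OctantEntropy`: the critical cluster
seen in the window `W_K = [-2^K, 2^K)^d`): the normalised counting measure of the non-empty
`A ⊆ W_K ∩ ℤ^d`, rescaled into `[0,1)^d`. [folklore] -/
def latticeState (K : ℕ) (A : Finset (Fin d → ℤ)) (hA : A.Nonempty)
    (hW : ∀ u ∈ A, ∀ i, -(2 ^ K : ℤ) ≤ u i ∧ u i < 2 ^ K) : CPState d :=
  ⟨⟨latticeMeasure d K A, ⟨by
      rw [latticeMeasure_apply K A MeasurableSet.univ]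
      simp only [indicator_univ, Pi.one_apply, Finset.sum_const, nsmul_eq_mul, mul_one]
      exact ENNReal.inv_mul_cancel (by exact_mod_cast hA.card_pos.ne') (ENNReal.natCast_ne_top _)⟩⟩, by
      change latticeMeasure d K A (unitCube d) = 1
      rw [latticeMeasure_apply K A measurableSet_unitCube]
      have : ∑ u ∈ A, (unitCube d).indicator (1 : (Fin d → ℝ) → ℝ≥0∞) (latticePoint d K u) = A.card := by
        rw [Finset.sum_congr rfl fun u hu => indicator_of_mem (latticePoint_mem_unitCube (hW u hu)) 1]
        simp
      rw [this]
      exact ENNReal.inv_mul_cancel (by exact_mod_cast hA.card_pos.ne') (ENNReal.natCast_ne_top _)⟩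

end Literature.Dynamics.FractalDistributions

end
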